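import Summits.QuantumFields.QCD.Theses.GapBuysCauchyRate
import Literature.MathematicalPhysics.QuantumFieldTheory.GaugeCovariantBlockMap
import Summits.QuantumFields.QCD.Theorems.QuarksAsStableActionStableActionBridgeDefs

/-!
# Stub `stub_speciesMultilinear` of line `birth` for crux `GapBuysCauchyRate.LadderCauchyRate`
(item stmt-QuantumFields-17307, route route-QuantumFields-GapBuysCauchyRate, sub-problem QCD)

What is proved: the species multilinearity (E1) of the lattice QCD one- and two-point functions of a
regularised scheme `reg.scheme m z shift`: (1) `onePoint` scales by `z_s(k)` and (2) the diagonal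
`twoPoint` by `z_s(k)²` relative to the `z ≡ 1` scheme with the same shifts, and (3) the `z ≡ 1`
one-point function is the smeared sum `Σ_x a⁴ f(a x) (⟨O_s(x)⟩ − shift_s ⟨1⟩)` of honest torus
expectations `qcdTorusExpect` on the torus of side `2 L_k + 1`.

How: the landed bookkeeping of `Theorems/QuarksAsStableActionStableActionBridgeDefs`
(`qcdLatticeSchwinger_eq_qcdLatticeDist`, `qcdLatticeDist_apply` on the canonical tensor witness
`SchwartzMap.tensorFin`) writes every `n`-point function (`n ≥ 1`) as the finite sum over site tuples of
the torus moments `qcdTorusMomentStr` times the test-function values; `prod_ofFn_smul` pulls the factor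
`∏ᵢ z_{σᵢ}(k) a_k⁴` out of each moment (`qcdTorusMomentStr_factor`), so that for `reg.scheme m zz shift`
the whole `zz`-dependence is this explicit prefactor (`schwinger_scheme_eq`, `onePoint_scheme_eq`);
(1), (2) are then termwise `ring` identities, and (3) follows from the linearity
`⟨X − c⟩ = ⟨X⟩ − c⟨1⟩` of the torus functional for coefficient-regular `X`
(`qcdTorusExpect_sub_algebraMap`: `integral_sub` with integrability from
`ChiralDescent.InfimumDescent.integrable_apply_of_coeffRegular`).  Sources: Montvay–Münster 1994 §5.1
(composite fields, multiplicative renormalisation); Glimm–Jaffe 1987 §6.1.  Everything is proved.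

Pure theorem file (no definitions): the registered stub signature, proved in tree vocabulary.
-/

noncomputable section

namespace Summit.QuantumFields.QCD.Cruxes.LadderCauchyRate.Birth

open scoped BigOperators Topology Classical
open MeasureTheory Filter
open Literature.MathematicalPhysics.AQFT Literature.Probability.LatticeModels
  Literature.MathematicalPhysics.QuantumLattice Literature.MathematicalPhysics.QuantumFieldTheory
open Summit.QuantumFields.QCD.Theses.GapBuysCauchyRate

open Literature.MathematicalPhysics.QuantumLattice.GrassmannAlgebra
  Summit.QuantumFields.QCD.Cruxes.StableActionBridge.Sketch in
/-- **Linearity of the torus functional against a constant.** For a coefficient-regular Grassmann-valued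
function `X` of the gauge field, `⟨X − c⟩ = ⟨X⟩ − c ⟨1⟩` on every torus, at every `β` and all bare masses
(the Berezin integral is linear; both Berezin integrands are bounded and measurable, hence integrable against
the Wilson probability measure). -/
private theorem qcdTorusExpect_sub_algebraMap {Nf S : ℕ} [NeZero S] (β : ℝ) (mq : Fin Nf → ℝ)
    (X : GaugeConfig 4 S (Matrix.specialUnitaryGroup (Fin 3) ℂ) → FermiAlg Nf S) (hX : CoeffRegular X)
    (c : ℂ) :
    qcdTorusExpect β S mq (fun U => X U - algebraMap ℂ _ c) =
      qcdTorusExpect β S mq X - c * qcdTorusExpect β S mq (fun _ => 1) := by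
  haveI : IsProbabilityMeasure (wilsonMeasure (d := 4) (L := S) (fundamentalRep (Fin 3)) β) :=
    isProbabilityMeasure_wilsonMeasure_fundamental β
  have hB : CoeffRegular (fun U : GaugeConfig 4 S (Matrix.specialUnitaryGroup (Fin 3) ℂ) =>
      fermiBoltzmann U mq) := coeffRegular_qcdBoltzmann mq
  have hI1 : Integrable (fun U : GaugeConfig 4 S (Matrix.specialUnitaryGroup (Fin 3) ℂ) =>
      fermiIntegral (X U * fermiBoltzmann U mq))
      (wilsonMeasure (d := 4) (L := S) (fundamentalRep (Fin 3)) β) :=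
    Summit.QuantumFields.QCD.Cruxes.ChiralDescent.InfimumDescent.integrable_apply_of_coeffRegular
      (hX.mul hB) fermiIntegral _
  have hI2 : Integrable (fun U : GaugeConfig 4 S (Matrix.specialUnitaryGroup (Fin 3) ℂ) =>
      c * fermiIntegral (1 * fermiBoltzmann U mq))
      (wilsonMeasure (d := 4) (L := S) (fundamentalRep (Fin 3)) β) :=
    (Summit.QuantumFields.QCD.Cruxes.ChiralDescent.InfimumDescent.integrable_apply_of_coeffRegular
      ((coeffRegular_const (1 : FermiAlg Nf S)).mul hB) fermiIntegral _).const_mul c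
  have hpt : ∀ U : GaugeConfig 4 S (Matrix.specialUnitaryGroup (Fin 3) ℂ),
      fermiIntegral ((X U - algebraMap ℂ _ c) * fermiBoltzmann U mq) =
        fermiIntegral (X U * fermiBoltzmann U mq) - c * fermiIntegral (1 * fermiBoltzmann U mq) := by
    intro U
    rw [sub_mul, map_sub, Algebra.algebraMap_eq_smul_one, smul_mul_assoc, map_smul, smul_eq_mul]
  have hnum : ∫ U, fermiIntegral ((X U - algebraMap ℂ _ c) * fermiBoltzmann U mq)
        ∂(wilsonMeasure (d := 4) (L := S) (fundamentalRep (Fin 3)) β) =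
      (∫ U, fermiIntegral (X U * fermiBoltzmann U mq)
          ∂(wilsonMeasure (d := 4) (L := S) (fundamentalRep (Fin 3)) β)) -
        c * ∫ U, fermiIntegral (1 * fermiBoltzmann U mq)
          ∂(wilsonMeasure (d := 4) (L := S) (fundamentalRep (Fin 3)) β) := by
    simp_rw [hpt]
    rw [integral_sub hI1 hI2, integral_const_mul]
  unfold qcdTorusExpect
  rw [hnum, sub_div, mul_div_assoc]

open Summit.QuantumFields.QCD.Cruxes.StableActionBridge.Sketch in
/-- **The species renormalisations factor out of the torus moments**:
`W_σ(x) = (∏ᵢ z_{σᵢ}(k) a_k⁴) · ⟨∏ᵢ (O_{σᵢ}(xᵢ) − shift_{σᵢ}(k))⟩_{β_k, 2L_k+1, m(k)}` (ordered product;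
`prod_ofFn_smul`, linearity of the Berezin and Bochner integrals). -/
private theorem qcdTorusMomentStr_factor {Nf : ℕ} (sch : QCDScheme Nf) (k : ℕ) {n : ℕ}
    (σ : Fin n → QCDField Nf) (x : Fin n → _root_.Literature.Probability.LatticeModels.Site 4) :
    qcdTorusMomentStr sch k σ x =
      (∏ i, ((sch.z (σ i) k * sch.a k ^ 4 : ℝ) : ℂ)) *
        qcdTorusExpect (sch.β k) (sch.side k) (fun fl => sch.mq fl k)
          (fun U => (List.ofFn fun i => (insertion U (σ i) (x i) -
            algebraMap ℂ _ ((sch.shift (σ i) k : ℝ) : ℂ))).prod) := by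
  unfold qcdTorusMomentStr qcdTorusExpect qcdGaugeMeasure
  simp only [renormInsertion, prod_ofFn_smul, smul_mul_assoc, map_smul, smul_eq_mul,
    integral_const_mul]
  rw [mul_div_assoc]

open Summit.QuantumFields.QCD.Cruxes.StableActionBridge.Sketch in
/-- **Closed form of the `n`-point functions of a regularised scheme** (`n ≥ 1`): for
`reg.scheme m zz shift`, `⟨∏ᵢ Φ^{σᵢ}(fᵢ)⟩ = Σ_{x ∈ boxⁿ} (∏ᵢ zz_{σᵢ}(k) a_k⁴) ⟨∏ᵢ (O_{σᵢ}(xᵢ) − shift_{σᵢ}(k))⟩ ∏ᵢ fᵢ(a_k xᵢ)`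
on the torus of side `2 L_k + 1` at `β_k` and the bare masses of `reg` (which do not depend on `zz`,
`shift`); the whole `zz`-dependence is the explicit prefactor. -/
private theorem schwinger_scheme_eq {Nf : ℕ} (reg : QCDRegularisation Nf) (m : Fin Nf → ℝ)
    (zz shift : QCDField Nf → ℕ → ℝ) (k n : ℕ) (hn : n ≠ 0) (σ : Fin n → QCDField Nf)
    (f : Fin n → SchwartzMap (EuclideanSpace ℝ (Fin 4)) ℝ) :
    qcdLatticeSchwinger (reg.scheme m zz shift) k n σ f =
      ∑ x ∈ Fintype.piFinset (fun _ : Fin n => Literature.Probability.LatticeModels.box 4 (reg.L k)),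
        ((∏ i, ((zz (σ i) k * reg.a k ^ 4 : ℝ) : ℂ)) *
          qcdTorusExpect (reg.β k) (2 * reg.L k + 1) (fun fl => (reg.scheme m 0 0).mq fl k)
            (fun U => (List.ofFn fun i => (insertion U (σ i) (x i) -
              algebraMap ℂ _ ((shift (σ i) k : ℝ) : ℂ))).prod)) *
        ∏ i, ((f i (reg.a k • siteToE (x i)) : ℝ) : ℂ) := by
  rw [← qcdLatticeSchwinger_eq_qcdLatticeDist _ k n hn σ f _ (isTensorOf_tensorFin _),
    qcdLatticeDist_apply _ k hn]
  refine Finset.sum_congr rfl fun x _ => ?_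
  rw [SchwartzMap.tensorFin_apply, qcdTorusMomentStr_factor]
  rfl

open Summit.QuantumFields.QCD.Cruxes.StableActionBridge.Sketch in
/-- **Closed form of the one-point function of a regularised scheme**:
`⟨Φ^s(f)⟩ = Σ_{x ∈ box} zz_s(k) a_k⁴ ⟨O_s(x) − shift_s(k)⟩ f(a_k x)` (the `n = 1` case of
`schwinger_scheme_eq`, re-indexed from `Fin 1`-tuples of sites to sites). -/
private theorem onePoint_scheme_eq {Nf : ℕ} (reg : QCDRegularisation Nf) (m : Fin Nf → ℝ)
    (zz shift : QCDField Nf → ℕ → ℝ) (k : ℕ) (s : QCDField Nf)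
    (f : SchwartzMap (EuclideanSpace ℝ (Fin 4)) ℝ) :
    (reg.scheme m zz shift).onePoint k s f =
      ∑ x ∈ Literature.Probability.LatticeModels.box 4 (reg.L k),
        (((zz s k * reg.a k ^ 4 : ℝ) : ℂ) *
          qcdTorusExpect (reg.β k) (2 * reg.L k + 1) (fun fl => (reg.scheme m 0 0).mq fl k)
            (fun U => insertion U s x - algebraMap ℂ _ ((shift s k : ℝ) : ℂ))) *
        ((f (reg.a k • siteToE x) : ℝ) : ℂ) := by
  rw [QCDScheme.onePoint_eq, schwinger_scheme_eq reg m zz shift k 1 one_ne_zero, sum_piFinset_succ]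
  refine Finset.sum_congr rfl fun x _ => ?_
  rw [Fintype.piFinset_of_isEmpty, Fintype.sum_unique]
  simp only [Fin.prod_univ_one, Fin.cons_zero, List.ofFn_succ, List.ofFn_zero, List.prod_cons,
    List.prod_nil, mul_one]

/-- (E1) **species multilinearity** (size M, provable now: the `qcdLatticeDist` bookkeeping of
`Theorems/QuarksAsStableActionStableActionBridgeDefs`, `prod_ofFn_smul`, `integral_finset_sum`).
Registered signature = `SpeciesMultilinearStmt` written out. -/
theorem stub_speciesMultilinear :
    ∀ (Nf : ℕ) (reg : QCDRegularisation Nf) (m : Fin Nf → ℝ) (z shift : QCDField Nf → ℕ → ℝ) (k : ℕ)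
      (s : QCDField Nf) (g f : SchwartzMap (EuclideanSpace ℝ (Fin 4)) ℝ),
      (reg.scheme m z shift).onePoint k s f =
          ((z s k : ℝ) : ℂ) * (reg.scheme m (fun _ _ => (1 : ℝ)) shift).onePoint k s f ∧
      (reg.scheme m z shift).twoPoint k s s g f =
          ((z s k : ℝ) : ℂ) ^ 2 * (reg.scheme m (fun _ _ => (1 : ℝ)) shift).twoPoint k s s g f ∧
      (reg.scheme m (fun _ _ => (1 : ℝ)) shift).onePoint k s f =
          ∑ x ∈ Literature.Probability.LatticeModels.box 4 (reg.L k),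
            ((reg.a k ^ 4 * f (reg.a k • siteToE x) : ℝ) : ℂ) *
              (qcdTorusExpect (reg.β k) (2 * reg.L k + 1) (fun fl => (reg.scheme m 0 0).mq fl k)
                  (fun U => insertion U s x) -
                ((shift s k : ℝ) : ℂ) *
                  qcdTorusExpect (reg.β k) (2 * reg.L k + 1) (fun fl => (reg.scheme m 0 0).mq fl k)
                    (fun _ => 1)) := by
  intro Nf reg m z shift k s g f
  refine ⟨?_, ?_, ?_⟩
  · rw [onePoint_scheme_eq, onePoint_scheme_eq, Finset.mul_sum]
    refine Finset.sum_congr rfl fun x _ => ?_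
    push_cast
    ring
  · rw [QCDScheme.twoPoint_eq, QCDScheme.twoPoint_eq, schwinger_scheme_eq reg m z shift k 2 two_ne_zero,
      schwinger_scheme_eq reg m _ shift k 2 two_ne_zero, Finset.mul_sum]
    refine Finset.sum_congr rfl fun x _ => ?_
    simp only [Fin.prod_univ_two, Matrix.cons_val_zero, Matrix.cons_val_one]
    push_cast
    ring
  · rw [onePoint_scheme_eq]
    refine Finset.sum_congr rfl fun x _ => ?_
    rw [qcdTorusExpect_sub_algebraMap (reg.β k) _ (fun U => insertion U s x)
      (Summit.QuantumFields.QCD.Cruxes.StableActionBridge.Sketch.coeffRegular_insertion s x)]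
    push_cast
    ring

end Summit.QuantumFields.QCD.Cruxes.LadderCauchyRate.Birth

end
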